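import Summits.BirchSwinnertonDyer.BirchSwinnertonDyer.Theorems.TwoAdicConverseOrdLambdaHalfAtTwoGL1ResidualCountQRoad
import Literature.NumberTheory.EllipticCurves.ZpExtensionCyclotomicSplitPrimeNonsplitProofs
import Literature.NumberTheory.EllipticCurves.HeegnerHypothesisConjugatePlaceProofs
import HarnessLib

/-!
# Route `TwoAdicConverse` (rung S3), crux `OrdLambdaHalfAtTwo` (item stmt-BirchSwinnertonDyer-19556), line `kato_determinant_greenberg_two`:
# the GL(1) road through `Q` with «`w` does not split in `K_∞/K`» DISCHARGED (sequel of `…GL1ResidualCountQRoad`)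

Seat `cruxlead-stmt-BirchSwinnertonDyer-19556` g5 (LEAD PROVER, MODE LINE; `--supports` stmt-BirchSwinnertonDyer-19556, helper).  THEOREM ONLY; no definition, no named
fact, no `sorry`.  HONEST FRAMING: BSD is not proved by any of this; the crux and 6‴ are NOT proved here.

`thetaGreenbergDivisibility_of_residualCountQ` = `…_of_decomp_surjective` with `hsurjw` derived: `2` splits in the Greenberg field (Heegner hypothesis for `2N`, conjugate
place `exists_ne_natCast_mem_of_satisfiesHeegnerHypothesis`) and a prime above a split `2` of a quadratic field does not split in the cyclotomic `ℤ₂`-extension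
(`ZpExtension.IsCyclotomic.exists_mem_decomp_apply_eq_of_split`, p711914).  So the GL(1) road to 6‴ displays exactly: 6b `ResidualCountEqQAtTwo`, (Glob), one-place (Loc),
and the window inequality `2^{gD+corank}·#X^Σ[2]·#(E(K_∞)[2^∞]/2)·2 ≤ 4^{Q(κK,N)}`.

References: [GreenbergVatsal2000] §2; [Washington1997] §13.1; [Gross1991] §1.
-/

set_option linter.dupNamespace false
set_option autoImplicit false

noncomputable section

open scoped Classical NumberField
open WeierstrassCurve NumberField IsDedekindDomain Field CategoryTheory
open Literature.NumberTheory.EllipticCurves Literature.NumberTheory.EllipticCurves.Rank1Residual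
open Literature.NumberTheory.EllipticCurves.GreenbergVatsal2000 (datumStrictSelmer unramifiedOutside)
open Literature.NumberTheory.GaloisRepresentations
open Summit.BirchSwinnertonDyer.Rank1Residual.X11b (AcSelmer.bdpData AcSelmer.selmerAc AcSelmer.XAc)
open Summit.BirchSwinnertonDyer.Rank1Residual.X2.ResidualDevissageModules (StableSubgroup)

namespace Summit.BirchSwinnertonDyer.BirchSwinnertonDyer.Theorems.TwoAdicKatoDeterminant

/-- **Stub 6‴ datum by datum from the MEETING EXPONENT `Q` (pen RC-382 (1); kernel, p691349 §3 + p692237): the GL(1) road at ONE place above `w`.**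
On the line's habitat — `K` imaginary quadratic with the Heegner hypothesis for `2N` (`N` odd; in `OrdLambdaHalfAtTwo_of`: `N = N_E`, `K` the Greenberg field),
`κK` CYCLOTOMIC with topological generator, `w ∣ 2` (so `κK(D_w) = Γ` — «`w` does not split in `K_∞/K`», DERIVED here from the Literature theorem
`ZpExtension.IsCyclotomic.exists_mem_decomp_apply_eq_of_split`, lead g5 p711914, and the conjugate place of the Heegner hypothesis), `Σ = {v ∣ N}`, `Φ` the stable line of the rational `2`-torsion point — for every re-keyed Shapiro datum `S` over the
Greenberg dual `DGr`: the displayed binder 6b `ResidualCountEqQAtTwo` (`#R_w^Σ(K_∞, Φ) = 2^{Q(κK, N)}`, print-grade `GL(1)`), the two standard surjectivities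
(Glob) «every class of `R(E[2]/Φ)` lifts to an `E[2]`-class unramified outside `Σ ∪ {2}`» and the ONE-place (Loc) «every class of `H¹(K_{∞,w}, Φ)` is the
restriction of a class of `H¹(K_∞, Φ)` unramified outside `Σ ∪ {2}`», and the ONE inequality **`2^{gD + corank}·#X^Σ[2]·#(E(K_∞)[2^∞]/2)·2 ≤ 4^{Q(κK, N)}`**
(in `𝔽₂`-dimensions: `gD + corank + τ^Σ + t_∞ + 1 ≤ 2·Q`) imply `gD ≤ λ(X_Gr)` — through the `c = 0` lower half of the GL(1) sandwich
`#R(Φ)² ≤ 2^{λ+corank}·#X^Σ[2]·#(E(K_∞)[2^∞]/2)·2` (`TwoAdicGL1ResidualLineCount.sq_le_two_pow_lambda_mul_of_decomp_surjective`).  SUFFICIENT, not equivalent: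
the sandwich has width `2 + t_w`, and the POSITION of `λ(X_Gr) + corank + τ^Σ + t_∞` in the window `[2Q − 1, 2Q + 1 + t_w]` is pair-by-pair research content
(triage r1-2 (14)(ii)/(15)); this corollary closes 6‴ exactly at the bottom of the window.  `B2`'s residual input (`R_w^Σ(K_∞, Φ)` finite) is READ OFF 6b here.
[cite: GreenbergVatsal2000, §2 Prop. (2.1), Cor. (2.3), Prop. (2.8)] [cite: Ferrero1980AJM, Thm. (λ-formula for imaginary quadratic fields, p = 2)]
[cite: Washington1997, §13.3 Thm. 13.13] -/
theorem thetaGreenbergDivisibility_of_residualCountQ {W : WeierstrassCurve ℚ} [W.IsElliptic] [ContinuousSMul ℤ_[2] (W.tateModule 2)]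
    {A : WeierstrassCurve ℚ} [A.IsElliptic] [ContinuousSMul ℤ_[2] (A.tateModule 2)]
    {κ : ZpExtension ℚ 2} {γ : absoluteGaloisGroup ℚ} {I_W : Kato2004.IwasawaH1Data W 2 κ γ} {I_A : Kato2004.IwasawaH1Data A 2 κ γ}
    {v : HeightOneSpectrum (𝓞 ℚ)} {γᵥ : absoluteGaloisGroup (v.adicCompletion ℚ)}
    {J : Kato2004.LocalIwasawaH1Data κ v ((Kato2004.EulerSystemValues.tateRep W 2).toLocal v) γᵥ}
    {J' : Kato2004.LocalIwasawaH1Data κ v (Kato2004.tateLocalOrdinaryRep W 2 v) γᵥ}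
    {J_A : Kato2004.LocalIwasawaH1Data κ v ((Kato2004.EulerSystemValues.tateRep A 2).toLocal v) γᵥ}
    {uA : ((Kato2004.EulerSystemValues.tateRep A 2).toLocal v).toTopRep ⟶ ((Kato2004.EulerSystemValues.tateRep W 2).toLocal v).toTopRep}
    {hsurj : Function.Surjective
      (κ.toContinuousMonoidHom.comp (resGalOfEmb (closureEmb (K := ℚ) (v.adicCompletion ℚ))))}
    {hγ : κ.IsTopGenerator γ} {hγᵥ : κ.IsTopGenerator (resGalOfEmb (closureEmb (K := ℚ) (v.adicCompletion ℚ)) γᵥ)}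
    {K : Type} [Field K] [NumberField K] {κK : ZpExtension K 2} {γK : absoluteGaloisGroup K} [Fact (κK.IsTopGenerator γK)]
    {w : HeightOneSpectrum (𝓞 K)}
    {DGr : (W.baseChange K).GreenbergStrictSelmerDualData κK γK (AcSelmer.bdpData (MK W K) 2 w)}
    {Dfi : (W.baseChange K).GreenbergStrictSelmerDualData κK γK (fineData W K)}
    {L₀ L₀' : IwasawaAlgebra 2} {b b' : ℕ}
    (S : ThetaShapiroKatoGreenbergDatum I_W I_A J J' J_A uA hsurj hγ hγᵥ DGr Dfi L₀ L₀' b b')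
    (hK : IsImaginaryQuadratic K) {N : ℕ} (hN : Odd N) (hHeeg : SatisfiesHeegnerHypothesis (2 * N) K)
    (hκK : κK.IsCyclotomic) (hw : ((2 : ℕ) : 𝓞 K) ∈ w.asIdeal)
    (hSb : ∀ u : HeightOneSpectrum (𝓞 K), u ∉ {u : HeightOneSpectrum (𝓞 K) | ((N : ℕ) : 𝓞 K) ∈ u.asIdeal} →
      ((2 : ℕ) : 𝓞 K) ∉ u.asIdeal → (W.baseChange K).HasGoodReductionAt u)
    (Φ : StableSubgroup (absoluteGaloisGroup K) ((W.baseChange K).geomTorsion (2 : ℤ))) (hΦ2 : Nat.card Φ.Sub = 2)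
    (h6b : ResidualCountEqQAtTwo)
    (hglob : ∀ z ∈ datumStrictSelmer κK.kerSubgroup Φ.Quot 2 (AcSelmer.bdpData Φ.Quot 2 w)
        {u : HeightOneSpectrum (𝓞 K) | ((N : ℕ) : 𝓞 K) ∈ u.asIdeal},
      ∃ y ∈ unramifiedOutside κK.kerSubgroup (↥((W.baseChange K).geomTorsion (2 : ℤ))) 2
          {u : HeightOneSpectrum (𝓞 K) | ((N : ℕ) : 𝓞 K) ∈ u.asIdeal},
        Literature.NumberTheory.EllipticCurves.resH1Hom (ContinuousMonoidHom.id κK.kerSubgroup) Φ.proj (fun _ x ↦ Φ.proj_smul _ x) y = z)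
    (hloc : ∀ u : Literature.NumberTheory.EllipticCurves.subgroupH1
        (κK.kerSubgroup ⊓ Literature.NumberTheory.EllipticCurves.GreenbergSelmer.decomp w) Φ.Sub,
      ∃ a ∈ unramifiedOutside κK.kerSubgroup Φ.Sub 2 {u : HeightOneSpectrum (𝓞 K) | ((N : ℕ) : 𝓞 K) ∈ u.asIdeal},
        Literature.NumberTheory.EllipticCurves.resOfLe Φ.Sub
          (inf_le_left : κK.kerSubgroup ⊓ Literature.NumberTheory.EllipticCurves.GreenbergSelmer.decomp w ≤ κK.kerSubgroup) a = u)
    (hineq : 2 ^ (S.gD + zpCorank (↥(AcSelmer.selmerAc (W.baseChange K) 2 κK w {u : HeightOneSpectrum (𝓞 K) | ((N : ℕ) : 𝓞 K) ∈ u.asIdeal}) ⧸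
            (AcSelmer.selmerAc (W.baseChange K) 2 κK w ∅).addSubgroupOf
              (AcSelmer.selmerAc (W.baseChange K) 2 κK w {u : HeightOneSpectrum (𝓞 K) | ((N : ℕ) : 𝓞 K) ∈ u.asIdeal})) 2) *
          Nat.card {x : AcSelmer.XAc (W.baseChange K) 2 κK w {u : HeightOneSpectrum (𝓞 K) | ((N : ℕ) : 𝓞 K) ∈ u.asIdeal} γK // 2 • x = 0} *
          Nat.card (↥(FixedPoints.addSubgroup κK.kerSubgroup (geomPrimaryTorsion (W.baseChange K) 2)) ⧸
            (DistribSMul.toAddMonoidHom (↥(FixedPoints.addSubgroup κK.kerSubgroup (geomPrimaryTorsion (W.baseChange K) 2))) 2).range) * 2 ≤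
        4 ^ meetingExponentQ κK N) :
    S.gD ≤ lambdaInvariant 2 DGr.X := by
  -- `w` does not split in `K_∞/K` (`κK(D_w) = Γ`): `2` splits in `K` (Heegner hypothesis for `2N`) and is totally ramified in `ℚ_∞`
  obtain ⟨v', hv'2, hv'ne⟩ := exists_ne_natCast_mem_of_satisfiesHeegnerHypothesis Nat.prime_two
    (hHeeg.of_dvd (dvd_mul_right 2 N)) w
  have hsurjw : ∀ g : Multiplicative ℤ_[2], ∃ δ ∈ Literature.NumberTheory.EllipticCurves.GreenbergSelmer.decomp w, κK δ = g :=
    ZpExtension.IsCyclotomic.exists_mem_decomp_apply_eq_of_split hK.1 hκK hw hv'2 hv'ne.symm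
  exact thetaGreenbergDivisibility_of_residualCountQ_of_decomp_surjective S hK hN hHeeg hκK hw hsurjw hSb Φ hΦ2 h6b hglob hloc hineq

end Summit.BirchSwinnertonDyer.BirchSwinnertonDyer.Theorems.TwoAdicKatoDeterminant

end
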